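import Summits.Ventures.HodgeRepro2.T5IsotypicCopies
import Summits.Ventures.HodgeRepro2.T5MultiplicityGeneral

/-!
# The isotypic decomposition: `V = ⨁_σ V_σ`, and `V_σ ≠ 0 ⟺ ∫ χ_π · conj χ_σ ≠ 0`

Blind cell `pub-hodge-repro2`, seat p1 (gen 12), Tier-5 kernel support for the «isotypic / K-type
decomposition» sentence of `route/T5-SUPPORT-p1.md` §S4.7.

With `T5IsotypicCopies.isotypic_eq_sup_copies` (the isotypic component is the sum of the copies in any
irreducible decomposition) the decomposition of `V` into isotypic components follows:

* `supIndep_id_of_isInternal` — the summands of an internal direct sum are `Finset.SupIndep`;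
* `disjoint_isotypic` — **isotypic components of inequivalent irreducibles are disjoint**
  (`V_σ ⊓ V_τ = ⊥`);
* `iSup_isotypic_eq_top` — **the isotypic components of the summands of an irreducible decomposition
  sum to `V`** (`⨆_{W ∈ S} V_{π|W} = ⊤`);
* `isotypic_eq_bot_iff_equivCount_eq_zero` and **`isotypic_eq_bot_iff_integral_eq_zero`** —
  `V_σ = 0 ⟺ ∫ χ_π · conj χ_σ dμ = 0` for a continuous `π` of a compact group and an irreducible
  unitary `σ` (the character detects which isotypic components occur);
* `finrank_sup_eq_sum_of_supIndep`, **`finrank_isotypic_eq_mul`** and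
  **`finrank_isotypic_eq_integral_mul`** — the dimension of the isotypic component is
  `(multiplicity of σ) · dim σ = (∫ χ_π · conj χ_σ dμ) · dim σ`.

Honest scope (unchanged): finite-dimensional representations, compact groups; nothing about U(1,1),
π₃⁺ or (N).
-/

namespace Summit.Ventures.HodgeRepro2.T5IsotypicDecomposition

open T5SchurOrthogonality T5CompleteReducibility T5RestrictionRep T5SchurMathlib T5IsotypicCopies

variable {G : Type*} [Group G]
variable {V : Type*} [NormedAddCommGroup V] [InnerProductSpace ℂ V] [FiniteDimensional ℂ V]
variable (π : G →* V →L[ℂ] V)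

section supIndep

variable (S : Finset (Submodule ℂ V))

omit [FiniteDimensional ℂ V] in
/-- The summands of an internal direct sum indexed by a `Finset` of submodules are `SupIndep`
(for the identity family). -/
theorem supIndep_id_of_isInternal (hint : DirectSum.IsInternal (fam S)) : S.SupIndep id := by
  classical
  intro t ht W hW hWt
  have hind := hint.submodule_iSupIndep
  have h1 : Disjoint (fam S ⟨W, hW⟩) (⨆ (j : S) (_ : j ≠ ⟨W, hW⟩), fam S j) :=
    iSupIndep_def.mp hind ⟨W, hW⟩
  refine h1.mono_right ?_
  refine Finset.sup_le fun W' hW' => ?_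
  have hW'S : W' ∈ S := ht hW'
  have hne : (⟨W', hW'S⟩ : S) ≠ ⟨W, hW⟩ := by
    intro h
    apply hWt
    have : W' = W := congrArg Subtype.val h
    exact this ▸ hW'
  exact le_iSup₂ (f := fun (j : S) (_ : j ≠ ⟨W, hW⟩) => fam S j) ⟨W', hW'S⟩ hne

omit [FiniteDimensional ℂ V] in
/-- Two sub-`Finset`s of an internal direct sum with no common summand have disjoint sums. -/
theorem disjoint_sup_sup_of_isInternal (hint : DirectSum.IsInternal (fam S))
    {t₁ t₂ : Finset (Submodule ℂ V)} (h₁ : t₁ ⊆ S) (h₂ : t₂ ⊆ S) (hd : Disjoint t₁ t₂) :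
    Disjoint (t₁.sup id) (t₂.sup id) :=
  (supIndep_id_of_isInternal S hint).disjoint_sup_sup h₁ h₂ hd

end supIndep

section decomposition

open Classical in
/-- **Isotypic components of inequivalent irreducibles are disjoint**, given an irreducible
internal-direct-sum decomposition `S` (`V_σ ⊓ V_τ = ⊥`). -/
theorem disjoint_isotypic_of_isInternal (S : Finset (Submodule ℂ V))
    (hint : DirectSum.IsInternal (fam S)) (hS : ∀ W ∈ S, IsIrreducibleSubspace π W)
    {W₀ W₁ : Type*} [NormedAddCommGroup W₀] [InnerProductSpace ℂ W₀] [NormedAddCommGroup W₁]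
    [InnerProductSpace ℂ W₁] (σ : G →* W₀ →L[ℂ] W₀) (τ : G →* W₁ →L[ℂ] W₁)
    (hστ : IsEmpty ((toRep σ).Equiv (toRep τ))) :
    Disjoint (isotypic π σ) (isotypic π τ) := by
  rw [isotypic_eq_sup_copies π σ S hint hS, isotypic_eq_sup_copies π τ S hint hS]
  refine disjoint_sup_sup_of_isInternal S hint (Finset.filter_subset _ _) (Finset.filter_subset _ _) ?_
  rw [Finset.disjoint_left]
  intro W hWσ hWτ
  obtain ⟨hσ, ⟨eσ⟩⟩ := (Finset.mem_filter.mp hWσ).2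
  obtain ⟨hτ, ⟨eτ⟩⟩ := (Finset.mem_filter.mp hWτ).2
  exact hστ.false (eσ.trans eτ.symm)

omit [FiniteDimensional ℂ V] in
/-- Every summand `W` of a decomposition is a copy of its own restriction `π|W`. -/
theorem isCopyOf_restrictRep {W : Submodule ℂ V} (hW : IsIrreducibleSubspace π W) :
    IsCopyOf π (restrictRep π W hW.2.1) W :=
  ⟨hW, ⟨Representation.Equiv.refl _⟩⟩

omit [FiniteDimensional ℂ V] in
/-- **The isotypic components of the summands of an irreducible decomposition sum to `V`**:
`⨆_{W ∈ S} V_{π|W} = ⊤`. -/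
theorem iSup_isotypic_eq_top (S : Finset (Submodule ℂ V))
    (hint : DirectSum.IsInternal (fam S)) (hS : ∀ W ∈ S, IsIrreducibleSubspace π W) :
    ⨆ W : S, isotypic π (restrictRep π W (hS W W.2).2.1) = ⊤ := by
  apply eq_top_iff.mpr
  rw [← hint.submodule_iSup_eq_top]
  exact iSup_mono fun W => le_isotypic_of_isCopyOf π _ (isCopyOf_restrictRep π (hS W W.2))

end decomposition

section count

variable {W₀ : Type*} [NormedAddCommGroup W₀] [InnerProductSpace ℂ W₀]
variable (σ : G →* W₀ →L[ℂ] W₀)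

omit [FiniteDimensional ℂ V] in
open Classical in
/-- For an irreducible decomposition `S` with stability proofs `hst`, the copies of `σ` among the
summands are exactly the summands counted by `T5MultiplicityGeneral.equivCount`. -/
theorem card_filter_isCopyOf_eq_equivCount (S : Finset (Submodule ℂ V))
    (hS : ∀ W ∈ S, IsIrreducibleSubspace π W) (hst : ∀ W ∈ S, IsStable π W) :
    (S.filter (IsCopyOf π σ)).card = T5MultiplicityGeneral.equivCount π σ S hst := by
  unfold T5MultiplicityGeneral.equivCount
  rw [Finset.card_filter, Finset.card_filter, ← Finset.sum_coe_sort S]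
  refine Finset.sum_congr rfl fun W _ => ?_
  congr 1
  refine propext ⟨fun h => ?_, fun h => ⟨hS W W.2, h⟩⟩
  obtain ⟨_, h⟩ := h
  exact h

open Classical in
/-- `V_σ = 0` iff `σ` occurs with multiplicity `0` in an irreducible decomposition `S`. -/
theorem isotypic_eq_bot_iff_equivCount_eq_zero (S : Finset (Submodule ℂ V))
    (hint : DirectSum.IsInternal (fam S)) (hS : ∀ W ∈ S, IsIrreducibleSubspace π W)
    (hst : ∀ W ∈ S, IsStable π W) :
    isotypic π σ = ⊥ ↔ T5MultiplicityGeneral.equivCount π σ S hst = 0 := by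
  rw [← card_filter_isCopyOf_eq_equivCount π σ S hS hst, isotypic_eq_sup_copies π σ S hint hS,
    Finset.card_eq_zero]
  constructor
  · intro h
    rw [Finset.eq_empty_iff_forall_notMem]
    intro W hW
    have hWb : W = ⊥ := by
      apply le_bot_iff.mp
      rw [← h]
      exact Finset.le_sup (f := id) hW
    exact (Finset.mem_filter.mp hW).2.1.1 hWb
  · intro h
    rw [h, Finset.sup_empty]

end count

section character

variable [TopologicalSpace G] [IsTopologicalGroup G] [MeasurableSpace G] [BorelSpace G]
  [CompactSpace G]
variable (μ : MeasureTheory.Measure G) [MeasureTheory.IsProbabilityMeasure μ] [μ.IsMulLeftInvariant]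
variable {W₀ : Type} [NormedAddCommGroup W₀] [InnerProductSpace ℂ W₀] [FiniteDimensional ℂ W₀]
variable (σ : G →* W₀ →L[ℂ] W₀)

/-- **The character detects the isotypic components**: for a continuous `π` of a compact group and a
continuous irreducible unitary `σ`, `V_σ = 0 ⟺ ∫ χ_π · conj χ_σ dμ = 0`. -/
theorem isotypic_eq_bot_iff_integral_eq_zero (hπ : Continuous π) (hσ : Continuous σ)
    (hσu : IsUnitary σ) [(toRep σ).IsIrreducible] :
    isotypic π σ = ⊥ ↔
      ∫ g, character π g * (starRingEnd ℂ) (character σ g) ∂μ = 0 := by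
  obtain ⟨S, hS, hint, hst, h⟩ :=
    T5MultiplicityGeneral.exists_decomposition_integral_character_eq_card π μ hπ
  rw [isotypic_eq_bot_iff_equivCount_eq_zero π σ S hint hS hst]
  have hσint := h σ hσ hσu
  rw [hσint]
  exact_mod_cast Iff.rfl

end character

section dimension

/-- The dimension of the sum of a `SupIndep` finite family of submodules of a finite-dimensional
space is the sum of the dimensions (`Finset` induction with `finrank_sup_add_finrank_inf_eq`). -/
theorem finrank_sup_eq_sum_of_supIndep (S : Finset (Submodule ℂ V)) (hS : S.SupIndep id) :
    Module.finrank ℂ (S.sup id : Submodule ℂ V) = ∑ W ∈ S, Module.finrank ℂ W := by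
  classical
  induction S using Finset.induction_on with
  | empty => simp
  | insert W S hW ih =>
    rw [Finset.sup_insert, Finset.sum_insert hW, ← ih (hS.subset (Finset.subset_insert W S))]
    have hd : Disjoint (id W) (S.sup id) :=
      hS (Finset.subset_insert W S) (Finset.mem_insert_self W S) hW
    have h := Submodule.finrank_sup_add_finrank_inf_eq (id W) (S.sup id)
    rw [disjoint_iff.mp hd, finrank_bot, add_zero] at h
    exact h

variable {W₀ : Type*} [NormedAddCommGroup W₀] [InnerProductSpace ℂ W₀]
variable (σ : G →* W₀ →L[ℂ] W₀)

omit [FiniteDimensional ℂ V] in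
/-- A copy of `σ` has the dimension of `σ` (the `Representation.Equiv` is a linear equivalence). -/
theorem finrank_of_isCopyOf {W : Submodule ℂ V} (hW : IsCopyOf π σ W) :
    Module.finrank ℂ W = Module.finrank ℂ W₀ := by
  obtain ⟨_, ⟨e⟩⟩ := hW
  exact e.toLinearEquiv.finrank_eq.symm

open Classical in
/-- **The dimension of the isotypic component** is the multiplicity of `σ` times `dim σ`:
`finrank V_σ = equivCount π σ S hst * finrank W₀` for every irreducible internal-direct-sum
decomposition `S`. -/
theorem finrank_isotypic_eq_mul (S : Finset (Submodule ℂ V)) (hint : DirectSum.IsInternal (fam S))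
    (hS : ∀ W ∈ S, IsIrreducibleSubspace π W) (hst : ∀ W ∈ S, IsStable π W) :
    Module.finrank ℂ (isotypic π σ) =
      T5MultiplicityGeneral.equivCount π σ S hst * Module.finrank ℂ W₀ := by
  rw [isotypic_eq_sup_copies π σ S hint hS,
    finrank_sup_eq_sum_of_supIndep _ ((supIndep_id_of_isInternal S hint).subset
      (Finset.filter_subset _ _)),
    Finset.sum_congr rfl fun W hW => finrank_of_isCopyOf π σ (Finset.mem_filter.mp hW).2,
    Finset.sum_const, smul_eq_mul]
  congr 1
  convert card_filter_isCopyOf_eq_equivCount π σ S hS hst using 2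

end dimension

section dimension_character

variable [TopologicalSpace G] [IsTopologicalGroup G] [MeasurableSpace G] [BorelSpace G]
  [CompactSpace G]
variable (μ : MeasureTheory.Measure G) [MeasureTheory.IsProbabilityMeasure μ] [μ.IsMulLeftInvariant]
variable {W₀ : Type} [NormedAddCommGroup W₀] [InnerProductSpace ℂ W₀] [FiniteDimensional ℂ W₀]
variable (σ : G →* W₀ →L[ℂ] W₀)

/-- **`dim V_σ = (∫ χ_π · conj χ_σ dμ) · dim σ`** for a continuous `π` of a compact group and a
continuous irreducible unitary `σ`. -/
theorem finrank_isotypic_eq_integral_mul (hπ : Continuous π) (hσ : Continuous σ)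
    (hσu : IsUnitary σ) [(toRep σ).IsIrreducible] :
    (Module.finrank ℂ (isotypic π σ) : ℂ) =
      (∫ g, character π g * (starRingEnd ℂ) (character σ g) ∂μ) * Module.finrank ℂ W₀ := by
  obtain ⟨S, hS, hint, hst, h⟩ :=
    T5MultiplicityGeneral.exists_decomposition_integral_character_eq_card π μ hπ
  have hσint := h σ hσ hσu
  rw [hσint, finrank_isotypic_eq_mul π σ S hint hS hst]
  push_cast
  rfl

end dimension_character

end Summit.Ventures.HodgeRepro2.T5IsotypicDecomposition
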